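import Literature.Topology.FourManifolds.ToralShellSwap
import Literature.Topology.FourManifolds.DisjointUnionPartialHomeomorph
import Mathlib.Analysis.SpecialFunctions.Pow.Real
import Mathlib.Analysis.Complex.ExponentialBounds
import HarnessLib

/-!
# The tube-swap gluing of Akbulut–Ruberman's cobordism `X` (Lemma 2.3): data and gluing map

Topic `Literature/Topology/FourManifolds`; brick A4c of the construction of the cobordism
`X = M × I - (L × D² × I) ∪ ∐ᵢ (S³ × I - Cᵢ × D²)` of S. Akbulut, D. Ruberman, *Absolutely exotic
compact 4-manifolds*, Comment. Math. Helv. 91 (2016), Lemma 2.3 ("where we glue the longitudes of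
each `Kᵢ` to the respective meridian of `Lᵢ` and vice versa"), for the fact seat of
`Literature.Barriers.SmoothPoincare4.akbulutRuberman2016_symmetryKillingCobordism`.

`X` is realised as a slab of a height function on an OPEN glued 4-manifold `Y = A ∪_Φ B`
(`GluingConstruction.lean`), the open gluing of

* `A = (M - ⋃ᵢ ψᵢ⁻¹(𝕊 1 × B̄(0, t₀))) × (-∞, 3/2)` — the product of the complement of closed tubes
  around the link components with an open interval of heights; here `ψᵢ : M ⊇ Uᵢ ⇀ 𝕊 1 × ℝ²`
  are disjoint solid-torus charts of the closed 3-manifold `M` (the framed link `L`);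
* `B = ℝ⁴ - ⋃ᵢ ({cᵢ} ∪ τᵢ((𝕊 1 × (-∞, 3/2]) × B̄(0, ρ₁)))` — the complement of closed normal tubes of
  the extended concordance annuli; here `τᵢ : (𝕊 1 × (-∞, 2)) × B(0, 1) ⇀ ℝ⁴` is a framed tube of
  the annulus `C̃ᵢ` (the concordance `Cᵢ` from the unknot to `Kᵢ`, read in the spherical shell
  `1 < ‖y - cᵢ‖ < e` of `ℝ⁴` with `s ↦ e^s` the radial height, and extended conically below
  height `δ` by the standard `ε`-tube of the unknot and above height `1 - δ` by a tube of `Kᵢ`),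

along the partial diffeomorphism `Φ` which on the toral shell `t₀ < ‖w‖ < 1` of the `i`-th tube
at height `s` is `(p, s) ↦ τᵢ ((w/‖w‖, s), n(‖w‖) • u)`, `(u, w) = ψᵢ p` — the shell swap of
`ToralShellSwap.lean` (longitude of `Lᵢ` ↦ meridian of `C̃ᵢ`, meridian of `Lᵢ` ↦ the annulus
circle, radius reversed by `n(t) = √(1 - c² t²)/ε`, so that approaching `Lᵢ` means leaving the
tube of `C̃ᵢ`). This file sets up the data (`TubeSwapData`), the radial profile, the
per-component gluing maps `glueᵢ : M × ℝ ⇀ ℝ⁴` with their smoothness, and their disjoint union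
`Φ`; the glued manifold, its Hausdorffness and the slab cobordism are the sequel files.

Everything here is proved; no named facts are introduced.

## References

* S. Akbulut, D. Ruberman, Comment. Math. Helv. 91 (2016), Lemma 2.3. [AkbulutRuberman2016]
* C. McA. Gordon, *Knots, homology spheres, and contractible 4-manifolds*, Topology 14 (1975).
  [Gordon1975]
-/

open scoped Manifold ContDiff
open scoped _root_.Topology
open Set Function Metric

noncomputable section

namespace Literature.Topology.FourManifolds

universe u

/-- Local notation: `𝔼 n` is the model Euclidean space `EuclideanSpace ℝ (Fin n)`. -/
local notation "𝔼 " n:arg => EuclideanSpace ℝ (Fin n)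

/-- Local notation: `𝕊 n` is the unit sphere in `EuclideanSpace ℝ (Fin (n + 1))`. -/
local notation "𝕊 " n:arg => (Metric.sphere (0 : EuclideanSpace ℝ (Fin (n + 1))) 1)

attribute [local instance] fact_finrank_euclideanSpace_succ

namespace TubeSwap

/-! ### Pairs of plane vectors as points of `ℝ⁴` -/

/-- The point `(a₀, a₁, b₀, b₁)` of `ℝ⁴` with plane components `a`, `b` (`ℝ⁴ = ℂ × ℂ`).
[folklore] -/
def concat (a b : 𝔼 2) : 𝔼 4 := WithLp.toLp 2 ![a 0, a 1, b 0, b 1]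

/-- Coordinate `0` of `concat a b` is `a 0`. [folklore] -/
@[simp] theorem concat_apply_zero (a b : 𝔼 2) : concat a b 0 = a 0 := rfl
/-- Coordinate `1` of `concat a b` is `a 1`. [folklore] -/
@[simp] theorem concat_apply_one (a b : 𝔼 2) : concat a b 1 = a 1 := rfl
/-- Coordinate `2` of `concat a b` is `b 0`. [folklore] -/
@[simp] theorem concat_apply_two (a b : 𝔼 2) : concat a b 2 = b 0 := rfl
/-- Coordinate `3` of `concat a b` is `b 1`. [folklore] -/
@[simp] theorem concat_apply_three (a b : 𝔼 2) : concat a b 3 = b 1 := rfl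

/-- `‖(a, b)‖² = ‖a‖² + ‖b‖²`. [folklore] -/
theorem norm_concat_sq (a b : 𝔼 2) : ‖concat a b‖ ^ 2 = ‖a‖ ^ 2 + ‖b‖ ^ 2 := by
  simp only [EuclideanSpace.norm_sq_eq, Fin.sum_univ_four, Fin.sum_univ_two, Real.norm_eq_abs,
    sq_abs, concat_apply_zero, concat_apply_one, concat_apply_two, concat_apply_three]
  ring

/-- `concat` is linear in the pair. [folklore] -/
theorem concat_add (a b a' b' : 𝔼 2) : concat (a + a') (b + b') = concat a b + concat a' b' := by
  ext i; fin_cases i <;> rfl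

/-- `concat` commutes with scalars. [folklore] -/
theorem concat_smul (r : ℝ) (a b : 𝔼 2) : concat (r • a) (r • b) = r • concat a b := by
  ext i; fin_cases i <;> rfl

/-- `concat` is `C^∞` (jointly in the pair). [folklore] -/
theorem contDiff_concat : ContDiff ℝ ∞ (fun p : (𝔼 2) × 𝔼 2 => concat p.1 p.2) := by
  rw [contDiff_euclidean]
  have h1 : ∀ i, ContDiff ℝ ∞ (fun p : (𝔼 2) × 𝔼 2 => p.1 i) := fun i =>
    (contDiff_euclidean.mp contDiff_fst) i
  have h2 : ∀ i, ContDiff ℝ ∞ (fun p : (𝔼 2) × 𝔼 2 => p.2 i) := fun i =>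
    (contDiff_euclidean.mp contDiff_snd) i
  intro i
  fin_cases i
  · exact h1 0
  · exact h1 1
  · exact h2 0
  · exact h2 1

/-! ### The standard `ε`-tube of the unknot in `𝕊³` -/

/-- **The standard tube of scale `ε` of the unknot** `U = {z₂ = 0} ∩ 𝕊³`:
`(x, w) ↦ (√(1 - ε²‖w‖²) x, ε w) ∈ ℝ⁴` (a point of `𝕊³` for `ε‖w‖ ≤ 1`). [folklore] -/
def stdTube (ε : ℝ) (q : (𝕊 1) × 𝔼 2) : 𝔼 4 :=
  concat (Real.sqrt (1 - ε ^ 2 * ‖q.2‖ ^ 2) • (q.1 : 𝔼 2)) (ε • q.2)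

/-- The standard tube lands in the unit sphere when `ε‖w‖ ≤ 1`. [folklore] -/
theorem norm_stdTube {ε : ℝ} (hε : 0 ≤ ε) {q : (𝕊 1) × 𝔼 2} (h : ε * ‖q.2‖ ≤ 1) :
    ‖stdTube ε q‖ = 1 := by
  have h0 : 0 ≤ 1 - ε ^ 2 * ‖q.2‖ ^ 2 := by
    have : (ε * ‖q.2‖) ^ 2 ≤ 1 := by
      have := mul_nonneg hε (norm_nonneg q.2); nlinarith
    nlinarith [this]
  have hsq : ‖stdTube ε q‖ ^ 2 = 1 := by
    rw [stdTube, norm_concat_sq, norm_smul, norm_smul, norm_eq_of_mem_sphere, mul_one,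
      Real.norm_of_nonneg (Real.sqrt_nonneg _), Real.sq_sqrt h0, Real.norm_eq_abs, mul_pow,
      sq_abs]
    ring
  have hn : 0 ≤ ‖stdTube ε q‖ := norm_nonneg _
  nlinarith [hsq, hn]

/-! ### The radial profile -/

/-- Inner normal radius of the glued shell of the annulus tube. [folklore] -/
def ρ₁ : ℝ := 1 / 4
/-- Outer normal radius of the glued shell of the annulus tube. [folklore] -/
def ρ₂ : ℝ := 1 / 2
/-- Outer normal radius of the cut-off shell of the height function. [folklore] -/
def ρ₃ : ℝ := 3 / 4

/-- `0 < ρ₁`. [folklore] -/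
theorem ρ₁_pos : 0 < ρ₁ := by norm_num [ρ₁]
/-- `ρ₁ < ρ₂`. [folklore] -/
theorem ρ₁_lt_ρ₂ : ρ₁ < ρ₂ := by norm_num [ρ₁, ρ₂]
/-- `ρ₂ < ρ₃`. [folklore] -/
theorem ρ₂_lt_ρ₃ : ρ₂ < ρ₃ := by norm_num [ρ₂, ρ₃]
/-- `ρ₃ < 1`. [folklore] -/
theorem ρ₃_lt_one : ρ₃ < 1 := by norm_num [ρ₃]
/-- `0 < ρ₂`. [folklore] -/
theorem ρ₂_pos : 0 < ρ₂ := ρ₁_pos.trans ρ₁_lt_ρ₂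
/-- `ρ₂ < 1`. [folklore] -/
theorem ρ₂_lt_one : ρ₂ < 1 := ρ₂_lt_ρ₃.trans ρ₃_lt_one

section Profile

variable (ε : ℝ)

/-- The contraction factor `c = √(1 - ε²ρ₁²)` of the bottom solid torus. [folklore] -/
def cst : ℝ := Real.sqrt (1 - ε ^ 2 * ρ₁ ^ 2)

/-- The inner radius `t₀ = √(1 - ε²ρ₂²)/c` of the glued shell of the link tube. [folklore] -/
def t₀ : ℝ := Real.sqrt (1 - ε ^ 2 * ρ₂ ^ 2) / cst ε

/-- **The radial profile** `n(t) = √(1 - c²t²)/ε` (decreasing from `ρ₂` at `t₀` to `ρ₁` at `1`).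
[folklore] -/
def prof (t : ℝ) : ℝ := Real.sqrt (1 - cst ε ^ 2 * t ^ 2) / ε

/-- **The inverse profile** `m(r) = √(1 - ε²r²)/c`. [folklore] -/
def profInv (r : ℝ) : ℝ := Real.sqrt (1 - ε ^ 2 * r ^ 2) / cst ε

variable {ε} (hε : ε ∈ Ioo (0 : ℝ) 1)
include hε

/-- `ε² r² < 1` for `0 ≤ r ≤ 1` (as `ε < 1`). [folklore] -/
theorem one_sub_pos {r : ℝ} (hr0 : 0 ≤ r) (hr : r ≤ 1) : 0 < 1 - ε ^ 2 * r ^ 2 := by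
  have h1 : ε * r < 1 := by nlinarith [hε.1, hε.2]
  have h2 : 0 ≤ ε * r := mul_nonneg hε.1.le hr0
  nlinarith

/-- `c² = 1 - ε²ρ₁²`. [folklore] -/
theorem cst_sq : cst ε ^ 2 = 1 - ε ^ 2 * ρ₁ ^ 2 :=
  Real.sq_sqrt (one_sub_pos hε ρ₁_pos.le (ρ₁_lt_ρ₂.trans ρ₂_lt_one).le).le

/-- `0 < c`. [folklore] -/
theorem cst_pos : 0 < cst ε :=
  Real.sqrt_pos.2 (one_sub_pos hε ρ₁_pos.le (ρ₁_lt_ρ₂.trans ρ₂_lt_one).le)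

/-- `ε²ρ₁² > 0`. [folklore] -/
theorem ε_sq_mul_ρ₁_sq_pos : 0 < ε ^ 2 * ρ₁ ^ 2 := by
  have := hε.1; have := ρ₁_pos; positivity

/-- `c < 1`. [folklore] -/
theorem cst_lt_one : cst ε < 1 := by
  have h := cst_sq hε
  have hc := cst_pos hε
  have := ε_sq_mul_ρ₁_sq_pos hε
  nlinarith

/-- `0 < t₀`. [folklore] -/
theorem t₀_pos : 0 < t₀ ε :=
  div_pos (Real.sqrt_pos.2 (one_sub_pos hε ρ₂_pos.le ρ₂_lt_one.le)) (cst_pos hε)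

/-- `(c t₀)² = 1 - ε²ρ₂²`. [folklore] -/
theorem cst_mul_t₀_sq : (cst ε * t₀ ε) ^ 2 = 1 - ε ^ 2 * ρ₂ ^ 2 := by
  have hc := cst_pos hε
  rw [t₀, mul_div_cancel₀ _ hc.ne', Real.sq_sqrt (one_sub_pos hε ρ₂_pos.le ρ₂_lt_one.le).le]

/-- `t₀ < 1`. [folklore] -/
theorem t₀_lt_one : t₀ ε < 1 := by
  have h1 := cst_mul_t₀_sq hε
  have h2 := cst_sq hε
  have hc := cst_pos hε
  have ht := t₀_pos hε
  have hρ : ε ^ 2 * ρ₁ ^ 2 < ε ^ 2 * ρ₂ ^ 2 := by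
    have h3 : ρ₁ ^ 2 < ρ₂ ^ 2 := by nlinarith [ρ₁_pos, ρ₁_lt_ρ₂]
    have hε2 : 0 < ε ^ 2 := by have := hε.1; positivity
    exact mul_lt_mul_of_pos_left h3 hε2
  -- `(c t₀)² < c²`, `c, t₀ > 0` ⟹ `t₀ < 1`
  have hlt : (cst ε * t₀ ε) ^ 2 < (cst ε * 1) ^ 2 := by rw [h1, mul_one, h2]; linarith
  have := (pow_lt_pow_iff_left₀ (mul_pos hc ht).le (mul_pos hc one_pos).le two_ne_zero).1 hlt
  nlinarith

/-- The radicand of the profile is positive on `[0, 1]`. [folklore] -/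
theorem radicand_pos {t : ℝ} (ht0 : 0 ≤ t) (ht : t ≤ 1) : 0 < 1 - cst ε ^ 2 * t ^ 2 := by
  have h2 := cst_sq hε
  have : t ^ 2 ≤ 1 := by nlinarith
  have hpos := ε_sq_mul_ρ₁_sq_pos hε
  nlinarith [sq_nonneg (cst ε)]

/-- `ε² n(t)² = 1 - c²t²` for `0 ≤ t ≤ 1`. [folklore] -/
theorem ε_sq_mul_prof_sq {t : ℝ} (ht0 : 0 ≤ t) (ht : t ≤ 1) :
    ε ^ 2 * prof ε t ^ 2 = 1 - cst ε ^ 2 * t ^ 2 := by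
  rw [prof, div_pow, mul_div_cancel₀ _ (pow_ne_zero 2 hε.1.ne'),
    Real.sq_sqrt (radicand_pos hε ht0 ht).le]

/-- `0 < n(t)` for `0 ≤ t ≤ 1`. [folklore] -/
theorem prof_pos {t : ℝ} (ht0 : 0 ≤ t) (ht : t ≤ 1) : 0 < prof ε t :=
  div_pos (Real.sqrt_pos.2 (radicand_pos hε ht0 ht)) hε.1

omit hε in
/-- Two nonnegative reals with equal squares are equal. [folklore] -/
theorem eq_of_sq_eq {a b : ℝ} (ha : 0 ≤ a) (hb : 0 ≤ b) (h : a ^ 2 = b ^ 2) : a = b :=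
  (sq_eq_sq₀ ha hb).1 h

omit hε in
/-- Two nonnegative reals compare as their squares. [folklore] -/
theorem lt_of_sq_lt {a b : ℝ} (hb : 0 ≤ b) (h : a ^ 2 < b ^ 2) : a < b := by
  by_contra hab
  have : b ≤ a := not_lt.1 hab
  nlinarith

/-- `n(1) = ρ₁`. [folklore] -/
theorem prof_one : prof ε 1 = ρ₁ := by
  have h := ε_sq_mul_prof_sq hε zero_le_one le_rfl
  rw [one_pow, mul_one, cst_sq hε] at h
  have h' : prof ε 1 ^ 2 = ρ₁ ^ 2 := by
    have hε2 : 0 < ε ^ 2 := by have := hε.1; positivity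
    nlinarith
  exact eq_of_sq_eq (prof_pos hε zero_le_one le_rfl).le ρ₁_pos.le h'

/-- `n(t₀) = ρ₂`. [folklore] -/
theorem prof_t₀ : prof ε (t₀ ε) = ρ₂ := by
  have ht0 := (t₀_pos hε).le
  have ht1 := (t₀_lt_one hε).le
  have h := ε_sq_mul_prof_sq hε ht0 ht1
  rw [show cst ε ^ 2 * t₀ ε ^ 2 = (cst ε * t₀ ε) ^ 2 by ring, cst_mul_t₀_sq hε] at h
  have h' : prof ε (t₀ ε) ^ 2 = ρ₂ ^ 2 := by
    have hε2 : 0 < ε ^ 2 := by have := hε.1; positivity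
    nlinarith
  exact eq_of_sq_eq (prof_pos hε ht0 ht1).le ρ₂_pos.le h'

/-- The profile is strictly decreasing on `[0, 1]`. [folklore] -/
theorem prof_lt_prof {t t' : ℝ} (ht0 : 0 ≤ t) (htt' : t < t') (ht' : t' ≤ 1) :
    prof ε t' < prof ε t := by
  have h1 := ε_sq_mul_prof_sq hε ht0 (htt'.le.trans ht')
  have h2 := ε_sq_mul_prof_sq hε (ht0.trans htt'.le) ht'
  have hc := cst_pos hε
  have hε2 : 0 < ε ^ 2 := by have := hε.1; positivity
  have hlt' : ε ^ 2 * prof ε t' ^ 2 < ε ^ 2 * prof ε t ^ 2 := by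
    rw [h1, h2]
    have : t ^ 2 < t' ^ 2 := by nlinarith
    have hc2 : 0 < cst ε ^ 2 := by positivity
    nlinarith
  have hlt : prof ε t' ^ 2 < prof ε t ^ 2 := lt_of_mul_lt_mul_left hlt' hε2.le
  exact lt_of_sq_lt (prof_pos hε ht0 (htt'.le.trans ht')).le hlt

/-- **The profile maps `(t₀, 1)` into `(ρ₁, ρ₂)`.** [folklore] -/
theorem prof_mem {t : ℝ} (ht : t ∈ Ioo (t₀ ε) 1) : prof ε t ∈ Ioo ρ₁ ρ₂ := by
  constructor
  · rw [← prof_one hε]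
    exact prof_lt_prof hε ((t₀_pos hε).le.trans ht.1.le) ht.2 le_rfl
  · rw [← prof_t₀ hε]
    exact prof_lt_prof hε (t₀_pos hε).le ht.1 ht.2.le

/-- `c² m(r)² = 1 - ε²r²` for `0 ≤ r ≤ 1`. [folklore] -/
theorem cst_sq_mul_profInv_sq {r : ℝ} (hr0 : 0 ≤ r) (hr : r ≤ 1) :
    cst ε ^ 2 * profInv ε r ^ 2 = 1 - ε ^ 2 * r ^ 2 := by
  rw [profInv, div_pow, mul_div_cancel₀ _ (pow_ne_zero 2 (cst_pos hε).ne'),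
    Real.sq_sqrt (one_sub_pos hε hr0 hr).le]

/-- `0 < m(r)` for `0 ≤ r ≤ 1`. [folklore] -/
theorem profInv_pos {r : ℝ} (hr0 : 0 ≤ r) (hr : r ≤ 1) : 0 < profInv ε r :=
  div_pos (Real.sqrt_pos.2 (one_sub_pos hε hr0 hr)) (cst_pos hε)

/-- `n(t) ≤ 1` hmm — rather: `n(t) < 1` is not needed; we need `n(t) ≤ 1` to feed `profInv`:
for `0 ≤ t ≤ 1`, `ε² n² = 1 - c²t² ≤ 1`, and `ε < 1` does NOT give `n ≤ 1` (`n(0) = 1/ε > 1`).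
On the glued shell `t > t₀` we have `n(t) < ρ₂ < 1`, which is what is used. [folklore] -/
theorem prof_le_one {t : ℝ} (ht : t ∈ Ioo (t₀ ε) 1) : prof ε t ≤ 1 :=
  ((prof_mem hε ht).2.trans ρ₂_lt_one).le

/-- **`m (n t) = t` on the glued shell.** [folklore] -/
theorem profInv_prof {t : ℝ} (ht : t ∈ Ioo (t₀ ε) 1) : profInv ε (prof ε t) = t := by
  have ht0 : 0 ≤ t := (t₀_pos hε).le.trans ht.1.le
  have hn0 : 0 ≤ prof ε t := (prof_pos hε ht0 ht.2.le).le
  have hn1 : prof ε t ≤ 1 := prof_le_one hε ht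
  have h1 := cst_sq_mul_profInv_sq hε hn0 hn1
  rw [ε_sq_mul_prof_sq hε ht0 ht.2.le] at h1
  have hc := cst_pos hε
  have h2 : profInv ε (prof ε t) ^ 2 = t ^ 2 := by
    have hc2 : 0 < cst ε ^ 2 := by positivity
    nlinarith
  exact eq_of_sq_eq (profInv_pos hε hn0 hn1).le ht0 h2

/-- `m(ρ₁) = 1`. [folklore] -/
theorem profInv_ρ₁ : profInv ε ρ₁ = 1 := by
  rw [← prof_one hε]
  -- `1 ∉ (t₀, 1)`; redo the computation at `t = 1` directly
  have hn0 : 0 ≤ prof ε 1 := (prof_pos hε zero_le_one le_rfl).le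
  have hn1 : prof ε 1 ≤ 1 := by rw [prof_one hε]; exact (ρ₁_lt_ρ₂.trans ρ₂_lt_one).le
  have h1 := cst_sq_mul_profInv_sq hε hn0 hn1
  rw [ε_sq_mul_prof_sq hε zero_le_one le_rfl] at h1
  have hc := cst_pos hε
  have h2 : profInv ε (prof ε 1) ^ 2 = 1 ^ 2 := by
    have hc2 : 0 < cst ε ^ 2 := by positivity
    nlinarith
  exact eq_of_sq_eq (profInv_pos hε hn0 hn1).le zero_le_one h2

/-- `m(ρ₂) = t₀`. [folklore] -/
theorem profInv_ρ₂ : profInv ε ρ₂ = t₀ ε := by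
  have hn0 : 0 ≤ ρ₂ := ρ₂_pos.le
  have h1 := cst_sq_mul_profInv_sq hε hn0 ρ₂_lt_one.le
  rw [← cst_mul_t₀_sq hε] at h1
  have hc := cst_pos hε
  have h2 : profInv ε ρ₂ ^ 2 = t₀ ε ^ 2 := by
    have hc2 : 0 < cst ε ^ 2 := by positivity
    nlinarith
  exact eq_of_sq_eq (profInv_pos hε hn0 ρ₂_lt_one.le).le (t₀_pos hε).le h2

/-- The inverse profile is strictly decreasing on `[0, 1]`. [folklore] -/
theorem profInv_lt_profInv {r r' : ℝ} (hr0 : 0 ≤ r) (hrr' : r < r') (hr' : r' ≤ 1) :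
    profInv ε r' < profInv ε r := by
  have h1 := cst_sq_mul_profInv_sq hε hr0 (hrr'.le.trans hr')
  have h2 := cst_sq_mul_profInv_sq hε (hr0.trans hrr'.le) hr'
  have hc2 : 0 < cst ε ^ 2 := by have := cst_pos hε; positivity
  have hε2 : 0 < ε ^ 2 := by have := hε.1; positivity
  have hlt' : cst ε ^ 2 * profInv ε r' ^ 2 < cst ε ^ 2 * profInv ε r ^ 2 := by
    rw [h1, h2]
    have : r ^ 2 < r' ^ 2 := by nlinarith
    nlinarith
  have hlt : profInv ε r' ^ 2 < profInv ε r ^ 2 := lt_of_mul_lt_mul_left hlt' hc2.le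
  exact lt_of_sq_lt (profInv_pos hε hr0 (hrr'.le.trans hr')).le hlt

/-- **The inverse profile maps `(ρ₁, ρ₂)` into `(t₀, 1)`.** [folklore] -/
theorem profInv_mem {r : ℝ} (hr : r ∈ Ioo ρ₁ ρ₂) : profInv ε r ∈ Ioo (t₀ ε) 1 := by
  constructor
  · rw [← profInv_ρ₂ hε]
    exact profInv_lt_profInv hε (ρ₁_pos.le.trans hr.1.le) hr.2 ρ₂_lt_one.le
  · rw [← profInv_ρ₁ hε]
    exact profInv_lt_profInv hε ρ₁_pos.le hr.1 (hr.2.trans ρ₂_lt_one).le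

/-- **`n (m r) = r` on the target shell.** [folklore] -/
theorem prof_profInv {r : ℝ} (hr : r ∈ Ioo ρ₁ ρ₂) : prof ε (profInv ε r) = r := by
  have hm := profInv_mem hε hr
  have h := profInv_prof hε hm
  -- `m` is injective on `[0,1]` (strictly decreasing), and `m (n (m r)) = m r`
  have hr0 : 0 ≤ r := ρ₁_pos.le.trans hr.1.le
  have hr1 : r ≤ 1 := (hr.2.trans ρ₂_lt_one).le
  have hn0 : 0 ≤ prof ε (profInv ε r) :=
    (prof_pos hε ((t₀_pos hε).le.trans hm.1.le) hm.2.le).le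
  have hn1 : prof ε (profInv ε r) ≤ 1 := prof_le_one hε hm
  rcases lt_trichotomy (prof ε (profInv ε r)) r with hlt | heq | hgt
  · have := profInv_lt_profInv hε hn0 hlt hr1
    rw [h] at this
    exact absurd this (lt_irrefl _)
  · exact heq
  · have := profInv_lt_profInv hε hr0 hgt hn1
    rw [h] at this
    exact absurd this (lt_irrefl _)

/-- The profile is `C^∞` on `(t₀, 1)`. [folklore] -/
theorem contDiffOn_prof : ContDiffOn ℝ ∞ (prof ε) (Ioo (t₀ ε) 1) := by
  intro t ht
  have ht0 : 0 ≤ t := (t₀_pos hε).le.trans ht.1.le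
  have hrad : 1 - cst ε ^ 2 * t ^ 2 ≠ 0 := (radicand_pos hε ht0 ht.2.le).ne'
  exact (((contDiffAt_const.sub (contDiffAt_const.mul (contDiffAt_id.pow 2))).sqrt hrad).div_const
    ε).contDiffWithinAt

/-- The inverse profile is `C^∞` on `(ρ₁, ρ₂)`. [folklore] -/
theorem contDiffOn_profInv : ContDiffOn ℝ ∞ (profInv ε) (Ioo ρ₁ ρ₂) := by
  intro r hr
  have hr0 : 0 ≤ r := ρ₁_pos.le.trans hr.1.le
  have hrad : 1 - ε ^ 2 * r ^ 2 ≠ 0 := (one_sub_pos hε hr0 (hr.2.trans ρ₂_lt_one).le).ne'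
  exact (((contDiffAt_const.sub (contDiffAt_const.mul (contDiffAt_id.pow 2))).sqrt hrad).div_const
    (cst ε)).contDiffWithinAt

/-- **The radial swap profile of the tube swap**: source shell `(t₀, 1)`, target shell `(ρ₁, ρ₂)`,
`n(t) = √(1 - c²t²)/ε`, `m(r) = √(1 - ε²r²)/c`. [folklore] -/
def profile : RadialSwapProfile where
  t₀ := t₀ ε
  t₁ := 1
  r₀ := ρ₁
  r₁ := ρ₂
  n := prof ε
  m := profInv ε
  t₀_nonneg := (t₀_pos hε).le
  r₀_nonneg := ρ₁_pos.le
  n_mem := fun _ ht => prof_mem hε ht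
  m_mem := fun _ hr => profInv_mem hε hr
  m_n := fun _ ht => profInv_prof hε ht
  n_m := fun _ hr => prof_profInv hε hr
  contDiffOn_n := contDiffOn_prof hε
  contDiffOn_m := contDiffOn_profInv hε

/-- Field of the profile (definitional). [folklore] -/
@[simp] theorem profile_t₀ : (profile hε).t₀ = t₀ ε := rfl
/-- Field of the profile (definitional). [folklore] -/
@[simp] theorem profile_t₁ : (profile hε).t₁ = 1 := rfl
/-- Field of the profile (definitional). [folklore] -/
@[simp] theorem profile_r₀ : (profile hε).r₀ = ρ₁ := rfl
/-- Field of the profile (definitional). [folklore] -/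
@[simp] theorem profile_r₁ : (profile hε).r₁ = ρ₂ := rfl
/-- Field of the profile (definitional). [folklore] -/
@[simp] theorem profile_n : (profile hε).n = prof ε := rfl
/-- Field of the profile (definitional). [folklore] -/
@[simp] theorem profile_m : (profile hε).m = profInv ε := rfl

/-- **Consistency with the bottom solid torus**: on the glued shell, the standard `ε`-tube
point of the swapped coordinates is the point `(c w, √(1 - c²‖w‖²) u)` of the bottom solid
torus: `stdTube ε (w/‖w‖, n(‖w‖) • u) = concat (c • w) (√(1 - c²‖w‖²) • u)`. [folklore] -/
theorem stdTube_swapFun {q : (𝕊 1) × 𝔼 2} (hq : q ∈ (profile hε).shell) :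
    stdTube ε ((profile hε).swapFun q) =
      concat (cst ε • q.2) (Real.sqrt (1 - cst ε ^ 2 * ‖q.2‖ ^ 2) • (q.1 : 𝔼 2)) := by
  obtain ⟨u, w⟩ := q
  have hw : ‖w‖ ∈ Ioo (t₀ ε) 1 := hq
  have ht0 : 0 ≤ ‖w‖ := norm_nonneg _
  have hn := prof_pos hε ht0 hw.2.le
  simp only [RadialSwapProfile.swapFun, profile_n, stdTube]
  rw [norm_smul_coe_sphere hn.le]
  congr 1
  · -- `√(1 - ε² n²) • (w/‖w‖) = c • w`
    have h1 : 1 - ε ^ 2 * prof ε ‖w‖ ^ 2 = (cst ε * ‖w‖) ^ 2 := by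
      rw [ε_sq_mul_prof_sq hε ht0 hw.2.le]; ring
    rw [h1, Real.sqrt_sq (mul_nonneg (cst_pos hε).le ht0), mul_smul,
      norm_smul_coe_radialProjection]
  · -- `ε • (n • u) = √(1 - c²‖w‖²) • u`
    rw [smul_smul]
    congr 1
    have h2 : (ε * prof ε ‖w‖) ^ 2 = Real.sqrt (1 - cst ε ^ 2 * ‖w‖ ^ 2) ^ 2 := by
      rw [mul_pow, ε_sq_mul_prof_sq hε ht0 hw.2.le, Real.sq_sqrt (radicand_pos hε ht0 hw.2.le).le]
    exact eq_of_sq_eq (mul_pos hε.1 hn).le (Real.sqrt_nonneg _) h2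

end Profile

/-! ### The reassociation `((x, w), s) ↦ ((x, s), w)` -/

/-- The reassociation `((x, w), s) ↦ ((x, s), w)` from `(𝕊 1 × ℝ²) × ℝ` to `(𝕊 1 × ℝ) × ℝ²`.
[folklore] -/
def reassoc (q : ((𝕊 1) × 𝔼 2) × ℝ) : ((𝕊 1) × ℝ) × 𝔼 2 := ((q.1.1, q.2), q.1.2)

/-- Its inverse `((x, s), w) ↦ ((x, w), s)`. [folklore] -/
def reassocInv (r : ((𝕊 1) × ℝ) × 𝔼 2) : ((𝕊 1) × 𝔼 2) × ℝ := ((r.1.1, r.2), r.1.2)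

/-- `reassocInv ∘ reassoc = id` (definitional). [folklore] -/
@[simp] theorem reassocInv_reassoc (q : ((𝕊 1) × 𝔼 2) × ℝ) : reassocInv (reassoc q) = q := rfl
/-- `reassoc ∘ reassocInv = id` (definitional). [folklore] -/
@[simp] theorem reassoc_reassocInv (r : ((𝕊 1) × ℝ) × 𝔼 2) : reassoc (reassocInv r) = r := rfl

/-- The reassociation is smooth. [folklore] -/
theorem contMDiff_reassoc :
    ContMDiff (((𝓡 1).prod 𝓘(ℝ, 𝔼 2)).prod 𝓘(ℝ, ℝ)) (((𝓡 1).prod 𝓘(ℝ, ℝ)).prod 𝓘(ℝ, 𝔼 2)) ∞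
      reassoc :=
  ((contMDiff_fst.comp contMDiff_fst).prodMk contMDiff_snd).prodMk
    (contMDiff_snd.comp contMDiff_fst)

/-- The inverse reassociation is smooth. [folklore] -/
theorem contMDiff_reassocInv :
    ContMDiff (((𝓡 1).prod 𝓘(ℝ, ℝ)).prod 𝓘(ℝ, 𝔼 2)) (((𝓡 1).prod 𝓘(ℝ, 𝔼 2)).prod 𝓘(ℝ, ℝ)) ∞
      reassocInv :=
  ((contMDiff_fst.comp contMDiff_fst).prodMk contMDiff_snd).prodMk
    (contMDiff_snd.comp contMDiff_fst)

end TubeSwap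

/-! ### The data of the tube swap -/

open TubeSwap

/-- **The data of Akbulut–Ruberman's tube swap** (Lemma 2.3) on the closed 3-manifold `M`, for a
link with components indexed by `ι`:
* `ψ i` — pairwise disjoint solid-torus charts `M ⊇ Uᵢ ⇀ 𝕊 1 × ℝ²` (`C^∞` with `C^∞` inverse,
  target containing the tube of radius `5`): the framed link `L`;
* `τ i` — framed tubes `(𝕊 1 × (-∞, 2)) × B(0, 1) ⇀ ℝ⁴` of the extended concordance annuli
  `C̃ᵢ` (`C^∞` with `C^∞` inverse), **conical below height `δ`** over the standard `ε`-tube of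
  the unknot with apex `apex i` (`τ_bot`), **conical above height `1 - δ`** over a tube
  `topTube i` of the end knot `Kᵢ` in `𝕊³` (`τ_top`), and crossing the spheres
  `‖y - apex i‖ = 1, e` exactly at heights `0`, `1` (`τ_shell`: the tube lies in the spherical
  shell `1 < ‖y - apex i‖ < e` exactly over `0 < s < 1`, the framed version of the transversality
  clause of `Knot.IsConcordance`);
* apexes pairwise `≥ 100` apart (so that the blobs `τᵢ(…) ⊆ B̄(apex i, e²)` are disjoint).
[cite: AkbulutRuberman2016, Lemma 2.3] -/
structure TubeSwapData (ι : Type) (M : Type u) [TopologicalSpace M] [ChartedSpace (𝔼 3) M] where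
  /-- solid-torus charts of the link components -/
  ψ : ι → OpenPartialHomeomorph M ((𝕊 1) × 𝔼 2)
  contMDiffOn_ψ : ∀ i, ContMDiffOn (𝓡 3) ((𝓡 1).prod 𝓘(ℝ, 𝔼 2)) ∞ (ψ i) (ψ i).source
  contMDiffOn_ψ_symm :
    ∀ i, ContMDiffOn ((𝓡 1).prod 𝓘(ℝ, 𝔼 2)) (𝓡 3) ∞ (ψ i).symm (ψ i).target
  subset_target_ψ : ∀ i, (univ : Set (𝕊 1)) ×ˢ ball (0 : 𝔼 2) 5 ⊆ (ψ i).target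
  disjoint_ψ : Pairwise (Disjoint on fun i => (ψ i).source)
  /-- framed tubes of the extended concordance annuli -/
  τ : ι → OpenPartialHomeomorph (((𝕊 1) × ℝ) × 𝔼 2) (𝔼 4)
  source_τ : ∀ i, (τ i).source = ((univ : Set (𝕊 1)) ×ˢ Iio (2 : ℝ)) ×ˢ ball (0 : 𝔼 2) 1
  contMDiffOn_τ :
    ∀ i, ContMDiffOn (((𝓡 1).prod 𝓘(ℝ, ℝ)).prod 𝓘(ℝ, 𝔼 2)) (𝓡 4) ∞ (τ i) (τ i).source
  contMDiffOn_τ_symm :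
    ∀ i, ContMDiffOn (𝓡 4) (((𝓡 1).prod 𝓘(ℝ, ℝ)).prod 𝓘(ℝ, 𝔼 2)) ∞ (τ i).symm (τ i).target
  /-- the apexes of the cones -/
  apex : ι → 𝔼 4
  /-- the scale of the standard tube of the unknot at the bottom -/
  ε : ℝ
  ε_mem : ε ∈ Ioo (0 : ℝ) 1
  /-- the collar parameter of the conical ends -/
  δ : ℝ
  δ_mem : δ ∈ Ioo (0 : ℝ) (1 / 2)
  τ_bot : ∀ i (x : 𝕊 1) (s : ℝ) (w : 𝔼 2), s ≤ δ → ‖w‖ < 1 →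
    τ i ((x, s), w) = apex i + Real.exp s • stdTube ε (x, w)
  /-- tubes of the end knots in `𝕊³` -/
  topTube : ι → (𝕊 1) × 𝔼 2 → 𝔼 4
  norm_topTube : ∀ i (q : (𝕊 1) × 𝔼 2), ‖q.2‖ < 1 → ‖topTube i q‖ = 1
  τ_top : ∀ i (x : 𝕊 1) (s : ℝ) (w : 𝔼 2), 1 - δ ≤ s → s < 2 → ‖w‖ < 1 →
    τ i ((x, s), w) = apex i + Real.exp s • topTube i (x, w)
  τ_shell : ∀ i (x : 𝕊 1) (s : ℝ) (w : 𝔼 2), s < 2 → ‖w‖ < 1 →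
    (0 < s ↔ 1 < ‖τ i ((x, s), w) - apex i‖) ∧ (s < 1 ↔ ‖τ i ((x, s), w) - apex i‖ < Real.exp 1)
  apex_far : Pairwise fun i j => 100 ≤ ‖apex i - apex j‖

namespace TubeSwapData

variable {ι : Type} {M : Type u} [TopologicalSpace M] [ChartedSpace (𝔼 3) M]
  (D : TubeSwapData ι M)

/-- The radial swap profile of the data (`ToralShellSwap.lean`), from its scale `ε`. [folklore] -/
def P : RadialSwapProfile := profile D.ε_mem

/-- Field of the profile of the data (definitional). [folklore] -/
@[simp] theorem P_n : D.P.n = prof D.ε := rfl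
/-- Field of the profile of the data (definitional). [folklore] -/
@[simp] theorem P_m : D.P.m = profInv D.ε := rfl
/-- Field of the profile of the data (definitional). [folklore] -/
@[simp] theorem P_t₀ : D.P.t₀ = t₀ D.ε := rfl
/-- Field of the profile of the data (definitional). [folklore] -/
@[simp] theorem P_t₁ : D.P.t₁ = 1 := rfl
/-- Field of the profile of the data (definitional). [folklore] -/
@[simp] theorem P_r₀ : D.P.r₀ = ρ₁ := rfl
/-- Field of the profile of the data (definitional). [folklore] -/
@[simp] theorem P_r₁ : D.P.r₁ = ρ₂ := rfl

/-- Membership in the source of a tube `τ i`. [folklore] -/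
theorem mem_source_τ_iff (i : ι) (r : ((𝕊 1) × ℝ) × 𝔼 2) :
    r ∈ (D.τ i).source ↔ r.1.2 < 2 ∧ ‖r.2‖ < 1 := by
  rw [D.source_τ i]
  simp [mem_prod, mem_Iio]

/-! ### The per-component gluing maps `M × ℝ ⇀ ℝ⁴` -/

section Glue

variable (i : ι)

/-- The height bound of the glued region. [folklore] -/
def sTop : ℝ := 3 / 2

/-- **The forward gluing map of component `i`** at the level of `M × ℝ`:
`(p, s) ↦ τᵢ ((w/‖w‖, s), n(‖w‖) • u)`, `(u, w) = ψᵢ p` (junk where undefined).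
[cite: AkbulutRuberman2016, Lemma 2.3] -/
def glueFun (q : M × ℝ) : 𝔼 4 :=
  D.τ i (reassoc (D.P.swapFun (D.ψ i q.1), q.2))

/-- **The backward gluing map of component `i`**: `y ↦ (ψᵢ⁻¹ (w′/‖w′‖, m(‖w′‖) • x), s)`,
`((x, s), w′) = τᵢ⁻¹ y`. [folklore] -/
def glueInv (y : 𝔼 4) : M × ℝ :=
  ((D.ψ i).symm (D.P.symm.swapFun (reassocInv ((D.τ i).symm y)).1),
    (reassocInv ((D.τ i).symm y)).2)

/-- **The source of the `i`-th gluing map**: the points `(p, s)` with `p` in the toral shell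
`t₀ < ‖w‖ < 1` of the `i`-th solid-torus chart and `s < 3/2`. [folklore] -/
def glueSource : Set (M × ℝ) :=
  {q | q.1 ∈ (D.ψ i).source ∧ D.ψ i q.1 ∈ D.P.shell ∧ q.2 < sTop}

/-- **The target of the `i`-th gluing map**: the image under `τᵢ` of the normal shell
`ρ₁ < ‖w′‖ < ρ₂` at heights `s < 3/2`. [folklore] -/
def glueTarget : Set (𝔼 4) :=
  D.τ i '' {r | ‖r.2‖ ∈ Ioo ρ₁ ρ₂ ∧ r.1.2 < sTop}

/-- The parameter region of the target lies in the source of `τ i`. [folklore] -/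
theorem shellParam_subset_source :
    {r : ((𝕊 1) × ℝ) × 𝔼 2 | ‖r.2‖ ∈ Ioo ρ₁ ρ₂ ∧ r.1.2 < sTop} ⊆ (D.τ i).source := by
  intro r hr
  rw [D.mem_source_τ_iff]
  exact ⟨hr.2.trans (by norm_num [sTop]), hr.1.2.trans ρ₂_lt_one⟩

/-- Membership in the source. [folklore] -/
theorem mem_glueSource_iff (q : M × ℝ) :
    q ∈ D.glueSource i ↔ q.1 ∈ (D.ψ i).source ∧ ‖(D.ψ i q.1).2‖ ∈ Ioo (t₀ D.ε) 1 ∧ q.2 < sTop :=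
  Iff.rfl

/-- The source is open. [folklore] -/
theorem isOpen_glueSource : IsOpen (D.glueSource i) := by
  have h1 : IsOpen {q : M × ℝ | q.1 ∈ (D.ψ i).source ∧ D.ψ i q.1 ∈ D.P.shell} :=
    ((D.ψ i).isOpen_inter_preimage D.P.isOpen_shell).preimage continuous_fst
  have h2 : IsOpen {q : M × ℝ | q.2 < sTop} := isOpen_Iio.preimage continuous_snd
  convert h1.inter h2 using 1
  ext q
  simp only [glueSource, mem_setOf_eq, mem_inter_iff, and_assoc]

/-- The target is open (image of an open subset of the source of `τ i`). [folklore] -/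
theorem isOpen_glueTarget : IsOpen (D.glueTarget i) := by
  refine ((D.τ i).isOpen_image_iff_of_subset_source (D.shellParam_subset_source i)).2 ?_
  have h1 : IsOpen {r : ((𝕊 1) × ℝ) × 𝔼 2 | ‖r.2‖ ∈ Ioo ρ₁ ρ₂} :=
    isOpen_Ioo.preimage (continuous_norm.comp continuous_snd)
  have h2 : IsOpen {r : ((𝕊 1) × ℝ) × 𝔼 2 | r.1.2 < sTop} :=
    isOpen_Iio.preimage (continuous_snd.comp continuous_fst)
  exact h1.inter h2

/-- On the source, the swapped point `((w/‖w‖, s), n(‖w‖) • u)` lies in the parameter region of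
the target. [folklore] -/
theorem reassoc_mem {q : M × ℝ} (hq : q ∈ D.glueSource i) :
    reassoc (D.P.swapFun (D.ψ i q.1), q.2) ∈
      {r : ((𝕊 1) × ℝ) × 𝔼 2 | ‖r.2‖ ∈ Ioo ρ₁ ρ₂ ∧ r.1.2 < sTop} := by
  refine ⟨?_, hq.2.2⟩
  show ‖(D.P.swapFun (D.ψ i q.1)).2‖ ∈ Ioo ρ₁ ρ₂
  rw [D.P.norm_swapFun_snd hq.2.1]
  exact D.P.n_mem _ hq.2.1

/-- The forward map sends the source into the target. [folklore] -/
theorem glueFun_mem {q : M × ℝ} (hq : q ∈ D.glueSource i) : D.glueFun i q ∈ D.glueTarget i :=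
  ⟨_, D.reassoc_mem i hq, rfl⟩

/-- **The backward map inverts the forward map on the source.** [folklore] -/
theorem glueInv_glueFun {q : M × ℝ} (hq : q ∈ D.glueSource i) :
    D.glueInv i (D.glueFun i q) = q := by
  obtain ⟨p, s⟩ := q
  have hmem := D.shellParam_subset_source i (D.reassoc_mem i hq)
  simp only [glueInv, glueFun]
  rw [(D.τ i).left_inv hmem, reassocInv_reassoc]
  simp only
  rw [D.P.symm_swapFun_swapFun hq.2.1, (D.ψ i).left_inv hq.1]

/-- **The forward map inverts the backward map on the target.** [folklore] -/
theorem glueFun_glueInv {y : 𝔼 4} (hy : y ∈ D.glueTarget i) : D.glueFun i (D.glueInv i y) = y := by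
  obtain ⟨r, hr, rfl⟩ := hy
  obtain ⟨⟨x, s⟩, w⟩ := r
  have hmem := D.shellParam_subset_source i hr
  have hw : ((x, w) : (𝕊 1) × 𝔼 2) ∈ D.P.symm.shell := hr.1
  have hψ : D.P.symm.swapFun (x, w) ∈ (D.ψ i).target := by
    refine D.subset_target_ψ i ⟨mem_univ _, ?_⟩
    rw [mem_ball_zero_iff, D.P.symm.norm_swapFun_snd hw]
    change D.P.m ‖w‖ < 5
    have h3 : D.P.m ‖w‖ < D.P.t₁ := (D.P.m_mem _ hw).2
    simp only [P_t₁] at h3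
    linarith
  simp only [glueFun, glueInv]
  rw [(D.τ i).left_inv hmem]
  simp only [reassocInv]
  rw [(D.ψ i).right_inv hψ, D.P.swapFun_symm_swapFun hw]
  rfl

/-- The backward map sends the target into the source. [folklore] -/
theorem glueInv_mem {y : 𝔼 4} (hy : y ∈ D.glueTarget i) : D.glueInv i y ∈ D.glueSource i := by
  obtain ⟨r, hr, rfl⟩ := hy
  obtain ⟨⟨x, s⟩, w⟩ := r
  have hmem := D.shellParam_subset_source i hr
  have hw : ((x, w) : (𝕊 1) × 𝔼 2) ∈ D.P.symm.shell := hr.1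
  have hsw : D.P.symm.swapFun (x, w) ∈ D.P.shell := by
    have h := D.P.symm.swapFun_mem hw
    exact h
  have hψ : D.P.symm.swapFun (x, w) ∈ (D.ψ i).target := by
    refine D.subset_target_ψ i ⟨mem_univ _, ?_⟩
    rw [mem_ball_zero_iff]
    have := hsw.2
    simp only [P_t₁] at this
    linarith
  simp only [glueInv]
  rw [(D.τ i).left_inv hmem]
  simp only [reassocInv]
  refine ⟨(D.ψ i).map_target hψ, ?_, hr.2⟩
  rw [(D.ψ i).right_inv hψ]
  exact hsw

/-- **Smoothness of the forward map on the source** (composite of `ψᵢ`, the shell swap, the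
reassociation and `τᵢ`). [folklore] -/
theorem contMDiffOn_glueFun :
    ContMDiffOn ((𝓡 3).prod 𝓘(ℝ, ℝ)) (𝓡 4) ∞ (D.glueFun i) (D.glueSource i) := by
  have h1 : ContMDiffOn ((𝓡 3).prod 𝓘(ℝ, ℝ)) (((𝓡 1).prod 𝓘(ℝ, 𝔼 2)).prod 𝓘(ℝ, ℝ)) ∞
      (fun q : M × ℝ => (D.P.swapFun (D.ψ i q.1), q.2)) (D.glueSource i) := by
    refine ContMDiffOn.prodMk ?_ contMDiff_snd.contMDiffOn
    have hψ : ContMDiffOn ((𝓡 3).prod 𝓘(ℝ, ℝ)) ((𝓡 1).prod 𝓘(ℝ, 𝔼 2)) ∞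
        (fun q : M × ℝ => D.ψ i q.1) (D.glueSource i) :=
      (D.contMDiffOn_ψ i).comp contMDiff_fst.contMDiffOn fun q hq => hq.1
    exact D.P.contMDiffOn_swapFun.comp hψ fun q hq => hq.2.1
  have h2 : ContMDiffOn ((𝓡 3).prod 𝓘(ℝ, ℝ)) (((𝓡 1).prod 𝓘(ℝ, ℝ)).prod 𝓘(ℝ, 𝔼 2)) ∞
      (fun q : M × ℝ => reassoc (D.P.swapFun (D.ψ i q.1), q.2)) (D.glueSource i) :=
    contMDiff_reassoc.comp_contMDiffOn h1
  exact (D.contMDiffOn_τ i).comp h2 fun q hq => D.shellParam_subset_source i (D.reassoc_mem i hq)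

/-- The target lies in the target of `τ i`. [folklore] -/
theorem glueTarget_subset_target : D.glueTarget i ⊆ (D.τ i).target := by
  rintro _ ⟨r, hr, rfl⟩
  exact (D.τ i).map_source (D.shellParam_subset_source i hr)

/-- On the target, `τᵢ⁻¹` lands in the parameter region. [folklore] -/
theorem symm_mem_of_mem_glueTarget {y : 𝔼 4} (hy : y ∈ D.glueTarget i) :
    (D.τ i).symm y ∈ {r : ((𝕊 1) × ℝ) × 𝔼 2 | ‖r.2‖ ∈ Ioo ρ₁ ρ₂ ∧ r.1.2 < sTop} := by
  obtain ⟨r, hr, rfl⟩ := hy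
  rwa [(D.τ i).left_inv (D.shellParam_subset_source i hr)]

/-- **Smoothness of the backward map on the target.** [folklore] -/
theorem contMDiffOn_glueInv :
    ContMDiffOn (𝓡 4) ((𝓡 3).prod 𝓘(ℝ, ℝ)) ∞ (D.glueInv i) (D.glueTarget i) := by
  have h0 : ContMDiffOn (𝓡 4) (((𝓡 1).prod 𝓘(ℝ, 𝔼 2)).prod 𝓘(ℝ, ℝ)) ∞
      (fun y => reassocInv ((D.τ i).symm y)) (D.glueTarget i) :=
    contMDiff_reassocInv.comp_contMDiffOn
      ((D.contMDiffOn_τ_symm i).mono (D.glueTarget_subset_target i))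
  have hshell : ∀ y ∈ D.glueTarget i, (reassocInv ((D.τ i).symm y)).1 ∈ D.P.symm.shell :=
    fun y hy => (D.symm_mem_of_mem_glueTarget i hy).1
  have h1 : ContMDiffOn (𝓡 4) ((𝓡 1).prod 𝓘(ℝ, 𝔼 2)) ∞
      (fun y => D.P.symm.swapFun (reassocInv ((D.τ i).symm y)).1) (D.glueTarget i) :=
    D.P.symm.contMDiffOn_swapFun.comp (contMDiff_fst.comp_contMDiffOn h0) hshell
  have htgt : ∀ y ∈ D.glueTarget i,
      D.P.symm.swapFun (reassocInv ((D.τ i).symm y)).1 ∈ (D.ψ i).target := by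
    intro y hy
    refine D.subset_target_ψ i ⟨mem_univ _, ?_⟩
    rw [mem_ball_zero_iff]
    have h := (D.P.symm.swapFun_mem (hshell y hy)).2
    simp only [RadialSwapProfile.symm, P_t₁] at h
    change ‖(D.P.symm.swapFun (reassocInv ((D.τ i).symm y)).1).2‖ < 1 at h
    linarith
  refine ContMDiffOn.prodMk ?_ (contMDiff_snd.comp_contMDiffOn h0)
  exact (D.contMDiffOn_ψ_symm i).comp h1 htgt

/-- **The `i`-th gluing partial diffeomorphism** `M × ℝ ⇀ ℝ⁴` of the tube swap.
[cite: AkbulutRuberman2016, Lemma 2.3] -/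
def glue : OpenPartialHomeomorph (M × ℝ) (𝔼 4) where
  toFun := D.glueFun i
  invFun := D.glueInv i
  source := D.glueSource i
  target := D.glueTarget i
  map_source' := fun _ hq => D.glueFun_mem i hq
  map_target' := fun _ hy => D.glueInv_mem i hy
  left_inv' := fun _ hq => D.glueInv_glueFun i hq
  right_inv' := fun _ hy => D.glueFun_glueInv i hy
  open_source := D.isOpen_glueSource i
  open_target := D.isOpen_glueTarget i
  continuousOn_toFun := (D.contMDiffOn_glueFun i).continuousOn
  continuousOn_invFun := (D.contMDiffOn_glueInv i).continuousOn

/-- The source of the `i`-th gluing map (definitional). [folklore] -/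
@[simp] theorem glue_source : (D.glue i).source = D.glueSource i := rfl
/-- The target of the `i`-th gluing map (definitional). [folklore] -/
@[simp] theorem glue_target : (D.glue i).target = D.glueTarget i := rfl
/-- The `i`-th gluing map as a function (definitional). [folklore] -/
@[simp] theorem glue_apply (q : M × ℝ) : D.glue i q = D.glueFun i q := rfl
/-- The inverse of the `i`-th gluing map as a function (definitional). [folklore] -/
@[simp] theorem glue_symm_apply (y : 𝔼 4) : (D.glue i).symm y = D.glueInv i y := rfl

/-- The `i`-th gluing map is `C^∞` on its source. [folklore] -/
theorem contMDiffOn_glue :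
    ContMDiffOn ((𝓡 3).prod 𝓘(ℝ, ℝ)) (𝓡 4) ∞ (D.glue i) (D.glue i).source :=
  D.contMDiffOn_glueFun i

/-- The inverse of the `i`-th gluing map is `C^∞` on its target. [folklore] -/
theorem contMDiffOn_glue_symm :
    ContMDiffOn (𝓡 4) ((𝓡 3).prod 𝓘(ℝ, ℝ)) ∞ (D.glue i).symm (D.glue i).target :=
  D.contMDiffOn_glueInv i

end Glue

/-! ### Bounds: every tube point at height `< 3/2` lies within `8` of its apex -/

/-- `e^{3/2} < 8`. [folklore] -/
theorem exp_sTop_lt : Real.exp sTop < 8 := by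
  have h1 : Real.exp sTop < Real.exp 2 := Real.exp_lt_exp.2 (by norm_num [sTop])
  have h2 : Real.exp 2 = Real.exp 1 * Real.exp 1 := by rw [← Real.exp_add]; norm_num
  have h3 := Real.exp_one_lt_three
  have h4 := Real.exp_pos 1
  -- `e^{3/2} < e² = e·e < 9`; sharpen: `e < 2.72` gives `e² < 7.4 < 8`
  have h5 := Real.exp_one_lt_d9
  nlinarith

/-- **A tube point at height `s < 3/2` lies within distance `8` of the apex** (below height `1`
by the shell clause, above by the top cone). [folklore] -/
theorem norm_τ_sub_apex_lt (i : ι) {x : 𝕊 1} {s : ℝ} {w : 𝔼 2} (hs : s < sTop) (hw : ‖w‖ < 1) :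
    ‖D.τ i ((x, s), w) - D.apex i‖ < 8 := by
  have hs2 : s < 2 := hs.trans (by norm_num [sTop])
  by_cases h1 : s < 1
  · have h := ((D.τ_shell i x s w hs2 hw).2).1 h1
    have := Real.exp_one_lt_three
    linarith
  · have h1' : 1 - D.δ ≤ s := by have := D.δ_mem.1; linarith
    rw [D.τ_top i x s w h1' hs2 hw, add_sub_cancel_left, norm_smul, Real.norm_of_nonneg
      (Real.exp_pos s).le, D.norm_topTube i (x, w) hw, mul_one]
    exact (Real.exp_lt_exp.2 hs).trans exp_sTop_lt

/-- A tube point at height `s < 3/2` is not the apex. [folklore] -/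
theorem τ_ne_apex (i : ι) {x : 𝕊 1} {s : ℝ} {w : 𝔼 2} (hs : s < sTop) (hw : ‖w‖ < 1) :
    D.τ i ((x, s), w) ≠ D.apex i := by
  have hs2 : s < 2 := hs.trans (by norm_num [sTop])
  intro h
  by_cases h0 : 0 < s
  · have h1 := ((D.τ_shell i x s w hs2 hw).1).1 h0
    rw [h, sub_self, norm_zero] at h1
    linarith
  · have hs' : s ≤ D.δ := (not_lt.1 h0).trans D.δ_mem.1.le
    have h2 := D.τ_bot i x s w hs' hw
    rw [h] at h2
    have h3 : Real.exp s • stdTube D.ε (x, w) = 0 := by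
      have := congrArg (fun z => z - D.apex i) h2
      simpa using this.symm
    rw [smul_eq_zero] at h3
    rcases h3 with h3 | h3
    · exact (Real.exp_pos s).ne' h3
    · have h4 : ‖stdTube D.ε (x, w)‖ = 1 :=
        norm_stdTube D.ε_mem.1.le (by
          have := D.ε_mem.2; show D.ε * ‖w‖ ≤ 1; nlinarith [norm_nonneg w])
      rw [h3, norm_zero] at h4
      exact zero_ne_one h4

/-- The targets of the gluing maps lie in the balls of radius `8` about the apexes. [folklore] -/
theorem glueTarget_subset_ball (i : ι) : D.glueTarget i ⊆ ball (D.apex i) 8 := by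
  rintro _ ⟨⟨⟨x, s⟩, w⟩, hr, rfl⟩
  rw [mem_ball, dist_eq_norm]
  exact D.norm_τ_sub_apex_lt i hr.2 (hr.1.2.trans ρ₂_lt_one)

/-- The balls of radius `8` about distinct apexes are disjoint. [folklore] -/
theorem disjoint_ball_apex {i j : ι} (hij : i ≠ j) :
    Disjoint (ball (D.apex i) 8) (ball (D.apex j) 8) := by
  refine ball_disjoint_ball ?_
  rw [dist_eq_norm]
  have := D.apex_far hij
  linarith

/-- **The sources of the gluing maps are pairwise disjoint.** [folklore] -/
theorem pairwise_disjoint_glueSource : Pairwise (Disjoint on fun i => (D.glue i).source) := by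
  intro i j hij
  refine disjoint_left.2 fun q hqi hqj => ?_
  exact disjoint_left.1 (D.disjoint_ψ hij) hqi.1 hqj.1

/-- **The targets of the gluing maps are pairwise disjoint.** [folklore] -/
theorem pairwise_disjoint_glueTarget : Pairwise (Disjoint on fun i => (D.glue i).target) :=
  fun _ _ hij => (D.disjoint_ball_apex hij).mono (D.glueTarget_subset_ball _)
    (D.glueTarget_subset_ball _)

/-! ### The gluing map `Φ : M × ℝ ⇀ ℝ⁴` (all components at once) -/

variable [Nonempty ι]

/-- **The gluing partial diffeomorphism of the tube swap**, the disjoint union over the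
components of the link of the per-component gluing maps. [cite: AkbulutRuberman2016, Lemma 2.3] -/
def Φ : OpenPartialHomeomorph (M × ℝ) (𝔼 4) :=
  OpenPartialHomeomorph.iUnionOfDisjoint (fun i => D.glue i) D.pairwise_disjoint_glueSource
    D.pairwise_disjoint_glueTarget

/-- The source of `Φ` (definitional). [folklore] -/
theorem Φ_source : D.Φ.source = ⋃ i, D.glueSource i := rfl
/-- The target of `Φ` (definitional). [folklore] -/
theorem Φ_target : D.Φ.target = ⋃ i, D.glueTarget i := rfl

/-- On the `i`-th source `Φ` is the `i`-th gluing map. [folklore] -/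
theorem Φ_apply_of_mem {i : ι} {q : M × ℝ} (hq : q ∈ D.glueSource i) : D.Φ q = D.glueFun i q :=
  OpenPartialHomeomorph.iUnionOfDisjoint_apply_of_mem _ _ _ hq

/-- On the `i`-th target `Φ⁻¹` is the `i`-th backward map. [folklore] -/
theorem Φ_symm_apply_of_mem {i : ι} {y : 𝔼 4} (hy : y ∈ D.glueTarget i) :
    D.Φ.symm y = D.glueInv i y :=
  OpenPartialHomeomorph.iUnionOfDisjoint_symm_apply_of_mem _ _ _ hy

/-- `Φ` is `C^∞` on its source. [folklore] -/
theorem contMDiffOn_Φ : ContMDiffOn ((𝓡 3).prod 𝓘(ℝ, ℝ)) (𝓡 4) ∞ D.Φ D.Φ.source :=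
  contMDiffOn_iUnionOfDisjoint _ _ _ fun i => D.contMDiffOn_glue i

/-- `Φ⁻¹` is `C^∞` on its target. [folklore] -/
theorem contMDiffOn_Φ_symm : ContMDiffOn (𝓡 4) ((𝓡 3).prod 𝓘(ℝ, ℝ)) ∞ D.Φ.symm D.Φ.target :=
  contMDiffOn_iUnionOfDisjoint_symm _ _ _ fun i => D.contMDiffOn_glue_symm i

end TubeSwapData

end Literature.Topology.FourManifolds

end
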